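import Summits.Parity.GeneralizedHardyLittlewood.Theorems.BeyondDiagonalBeatsQuarter.OffDiagDualBoxSize
import Summits.Parity.GeneralizedHardyLittlewood.Theorems.BeyondDiagonalBeatsQuarter.OffDiagDualHyperbolaCount
import Summits.Parity.GeneralizedHardyLittlewood.Theorems.BeyondDiagonalBeatsQuarter.OffDiagDualAssembly
import HarnessLib

/-!
# Route `PrimeLevelFamEdge`, crux K_B (stmt-Parity-20343), line `diagonal_kernel_split` rev 4, plan Ω,
# worker key L3 (part 3) `OffDiagDualBoxLedger`: the TRIVIAL ledger of one truncated dual box on the coprime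
# stratum — `Σ_{|h_j| ≤ A_j} |Φ̂_i(h/(qr))|·N_{qr}(α,β;h) ≤ bulk(i,d,r,J) · (2A₁+1)(2A₂/(qr)+1)`

Assembly of L3 part 1 (`OffDiagDualBoxSize.norm_fourier2_boxWeight_le`: `|Φ̂_i(ξ)| ≤ bulk` uniformly in `ξ`,
`bulk = (9/4)K₁K₂·(d₁d₂K₁K₂/4)^{−1/2}W(d₁d₂K₁K₂/(4q̂²))r⁻¹J`), L3 part 2 (`OffDiagDualHyperbolaCount.card_hyperbolaBox_le`)
and W-a's coprime stratum (`OffDiagDual.dualCount_eq_ite_of_isUnit`: for `α` a unit mod `c`,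
`N_c(α,β;h) = 𝟙[h₁ unit ∧ h₁h₂ = αβ]`):
* **`sum_dualBox_norm_le`** — for `α` a unit mod `qr` and any `A₁, A₂`:
  `Σ_{(h₁,h₂) ∈ [-A₁,A₁]×[-A₂,A₂]} ‖Φ̂_i(h₁/(qr),h₂/(qr))‖·N_{qr}(α,β;h₁,h₂) ≤ bulk·(2A₁+1)·(2A₂/(qr)+1)`,
  with `J = 1` (`…_le_one`) and the Hankel size `J = 35(Z/2)^{−1/2}` (`…_le_hankel`);
* `sum_dualBox_norm_le_primeLevel` — at prime level `q`, `α = l/d₁ < q`, `(α, r) = 1` the unit hypothesis holds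
  (`OffDiagDual.isUnit_natCast_primeLevel`).
This is the per-box row of BLUEPRINT L3 («bulk × hyperbola density»); summing over `(i, d, r ≤ q⁷, l, m)` with
L2's truncation lengths `A_j = H_jq^{ε}` gives the `q^{κ₀η+o(1)}·Σms` total (next part, after L2's derivative costs).
Absolute values only; nothing about the heart. Helper (`--supports stmt-Parity-20343`); standard axioms.
«The programme SEARCHES and TYPES; no claim about Landau–Siegel zeros, Theorems 1–2 of arXiv:2211.02515 or
a repaired Margin232 until a kernel theorem says so.»
-/

noncomputable section

open Finset
open scoped Real

namespace Summit.Parity.GeneralizedHardyLittlewood.Theorems.BeyondDiagonalBeatsQuarter.OffDiag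

open Literature.NumberTheory.LFunctions Literature.NumberTheory.LFunctions.KMV2000
open Literature.Analysis.FunctionSpaces (besselJ)
open Literature.NumberTheory.Sieve.FriedlanderIwaniecPrimes (fourier2)
open OffDiagDual (dualCount_eq_ite_of_isUnit isUnit_natCast_primeLevel)

variable {q d₁ d₂ α β r : ℕ}

/-- **The trivial ledger of one truncated dual box (coprime stratum).** Let `q, d₁, d₂, α, β ≥ 1`, `qr ≥ 1`,
`α` a unit mod `qr`, `J ≥ 0` with `|J₁(x)| ≤ J` for `x ≥ Z/2` (`Z = 4π√(αβK₁K₂)/(qr)`, `K_j = 2^{i_j}`). Then for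
all `A₁, A₂`:
`Σ_{(h₁,h₂) ∈ [-A₁,A₁]×[-A₂,A₂]} ‖Φ̂_i(h₁/(qr), h₂/(qr))‖·N_{qr}(α,β;h₁,h₂)
   ≤ [(9/4)K₁K₂·(d₁d₂K₁K₂/4)^{−1/2}·W(d₁d₂K₁K₂/(4q̂²))·r⁻¹·J] · (2A₁+1)(2A₂/(qr)+1)`.
[cite: KowalskiMichelVanderKam2000, (21)–(23) p. 12 and Lemma 3.3 p. 9 — derivation] -/
theorem sum_dualBox_norm_le [NeZero q] [NeZero (q * r)] (hd₁ : 1 ≤ d₁) (hd₂ : 1 ≤ d₂) (hα : 1 ≤ α) (hβ : 1 ≤ β)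
    (hunit : IsUnit ((α : ℕ) : ZMod (q * r))) (i : ℕ × ℕ) {J : ℝ} (hJ0 : 0 ≤ J)
    (hJ : ∀ x : ℝ, 4 * π * Real.sqrt ((α : ℝ) * (β : ℝ) * ((2 : ℝ) ^ i.1 * 2 ^ i.2)) / ((q : ℝ) * r) / 2 ≤ x →
      |besselJ 1 x| ≤ J) (A₁ A₂ : ℕ) :
    ∑ h ∈ (Finset.Icc (-(A₁ : ℤ)) A₁) ×ˢ (Finset.Icc (-(A₂ : ℤ)) A₂),
        ‖fourier2 (boxWeight q d₁ d₂ α β r i) (h.1 / (q * r : ℕ)) (h.2 / (q * r : ℕ))‖ *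
          (dualCount (q * r) (α : ZMod (q * r)) (β : ZMod (q * r)) (h.1 : ZMod (q * r)) (h.2 : ZMod (q * r)) : ℝ) ≤
      (9 / 4 * ((2 : ℝ) ^ i.1 * 2 ^ i.2) *
          (((d₁ : ℝ) * d₂ * ((2 : ℝ) ^ i.1 * 2 ^ i.2) / 4) ^ (-(1 / 2 : ℝ)) *
            cutoffW ((d₁ : ℝ) * d₂ * ((2 : ℝ) ^ i.1 * 2 ^ i.2) / 4 / qhat q ^ 2) * (r : ℝ)⁻¹ * J)) *
        ((2 * A₁ + 1) * (2 * A₂ / (q * r : ℕ) + 1)) := by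
  classical
  set B : ℝ := 9 / 4 * ((2 : ℝ) ^ i.1 * 2 ^ i.2) *
    (((d₁ : ℝ) * d₂ * ((2 : ℝ) ^ i.1 * 2 ^ i.2) / 4) ^ (-(1 / 2 : ℝ)) *
      cutoffW ((d₁ : ℝ) * d₂ * ((2 : ℝ) ^ i.1 * 2 ^ i.2) / 4 / qhat q ^ 2) * (r : ℝ)⁻¹ * J) with hB
  have hB0 : 0 ≤ B := by
    have := cutoffW_nonneg ((d₁ : ℝ) * d₂ * ((2 : ℝ) ^ i.1 * 2 ^ i.2) / 4 / qhat q ^ 2)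
    positivity
  have hbulk : ∀ h : ℤ × ℤ, ‖fourier2 (boxWeight q d₁ d₂ α β r i) (h.1 / (q * r : ℕ)) (h.2 / (q * r : ℕ))‖ ≤ B :=
    fun h ↦ norm_fourier2_boxWeight_le hd₁ hd₂ hα hβ i hJ0 hJ _ _
  -- `N = 𝟙[unit ∧ hyperbola]` on the coprime stratum
  set P : ℤ × ℤ → Prop := fun h ↦ IsUnit ((h.1 : ℤ) : ZMod (q * r)) ∧
    ((h.1 : ℤ) : ZMod (q * r)) * ((h.2 : ℤ) : ZMod (q * r)) = (α : ZMod (q * r)) * (β : ZMod (q * r)) with hP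
  have hN : ∀ h : ℤ × ℤ,
      (dualCount (q * r) (α : ZMod (q * r)) (β : ZMod (q * r)) (h.1 : ZMod (q * r)) (h.2 : ZMod (q * r)) : ℝ) =
        if P h then 1 else 0 := by
    intro h
    rw [dualCount_eq_ite_of_isUnit hunit]
    split_ifs <;> simp
  set S := (Finset.Icc (-(A₁ : ℤ)) A₁) ×ˢ (Finset.Icc (-(A₂ : ℤ)) A₂) with hS
  have hcount := card_hyperbolaBox_le (q * r) A₁ A₂ ((α : ZMod (q * r)) * (β : ZMod (q * r)))
  calc ∑ h ∈ S, ‖fourier2 (boxWeight q d₁ d₂ α β r i) (h.1 / (q * r : ℕ)) (h.2 / (q * r : ℕ))‖ *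
        (dualCount (q * r) (α : ZMod (q * r)) (β : ZMod (q * r)) (h.1 : ZMod (q * r)) (h.2 : ZMod (q * r)) : ℝ)
      = ∑ h ∈ S, (if P h then
          ‖fourier2 (boxWeight q d₁ d₂ α β r i) (h.1 / (q * r : ℕ)) (h.2 / (q * r : ℕ))‖ else 0) := by
        refine Finset.sum_congr rfl fun h _ ↦ ?_
        rw [hN h]; split_ifs <;> simp
    _ = ∑ h ∈ S.filter P, ‖fourier2 (boxWeight q d₁ d₂ α β r i) (h.1 / (q * r : ℕ)) (h.2 / (q * r : ℕ))‖ :=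
        (Finset.sum_filter P _).symm
    _ ≤ ∑ h ∈ S.filter P, B := Finset.sum_le_sum fun h _ ↦ hbulk h
    _ = ((S.filter P).card : ℝ) * B := by rw [Finset.sum_const, nsmul_eq_mul]
    _ ≤ ((2 * A₁ + 1) * (2 * A₂ / (q * r : ℕ) + 1)) * B := mul_le_mul_of_nonneg_right hcount hB0
    _ = _ := by rw [hB]; ring

/-- **The ledger with `J = 1`.** [cite: KowalskiMichelVanderKam2000, (21)–(23) p. 12 and Lemma 3.3 p. 9 — derivation] -/
theorem sum_dualBox_norm_le_one [NeZero q] [NeZero (q * r)] (hd₁ : 1 ≤ d₁) (hd₂ : 1 ≤ d₂) (hα : 1 ≤ α)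
    (hβ : 1 ≤ β) (hunit : IsUnit ((α : ℕ) : ZMod (q * r))) (i : ℕ × ℕ) (A₁ A₂ : ℕ) :
    ∑ h ∈ (Finset.Icc (-(A₁ : ℤ)) A₁) ×ˢ (Finset.Icc (-(A₂ : ℤ)) A₂),
        ‖fourier2 (boxWeight q d₁ d₂ α β r i) (h.1 / (q * r : ℕ)) (h.2 / (q * r : ℕ))‖ *
          (dualCount (q * r) (α : ZMod (q * r)) (β : ZMod (q * r)) (h.1 : ZMod (q * r)) (h.2 : ZMod (q * r)) : ℝ) ≤
      (9 / 4 * ((2 : ℝ) ^ i.1 * 2 ^ i.2) *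
          (((d₁ : ℝ) * d₂ * ((2 : ℝ) ^ i.1 * 2 ^ i.2) / 4) ^ (-(1 / 2 : ℝ)) *
            cutoffW ((d₁ : ℝ) * d₂ * ((2 : ℝ) ^ i.1 * 2 ^ i.2) / 4 / qhat q ^ 2) * (r : ℝ)⁻¹ * 1)) *
        ((2 * A₁ + 1) * (2 * A₂ / (q * r : ℕ) + 1)) :=
  sum_dualBox_norm_le hd₁ hd₂ hα hβ hunit i zero_le_one
    (fun x _ ↦ Literature.Analysis.FunctionSpaces.abs_besselJ_one_le_one x) A₁ A₂

/-- **The ledger with the Hankel size `J = 35(Z/2)^{−1/2}`** (`r ≥ 1`).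
[cite: Iwaniec2002, Appendix B.4 (B.35); KowalskiMichelVanderKam2000, (21)–(23) p. 12 — derivation] -/
theorem sum_dualBox_norm_le_hankel [NeZero q] [NeZero (q * r)] (hd₁ : 1 ≤ d₁) (hd₂ : 1 ≤ d₂) (hα : 1 ≤ α)
    (hβ : 1 ≤ β) (hr : 1 ≤ r) (hunit : IsUnit ((α : ℕ) : ZMod (q * r))) (i : ℕ × ℕ) (A₁ A₂ : ℕ) :
    ∑ h ∈ (Finset.Icc (-(A₁ : ℤ)) A₁) ×ˢ (Finset.Icc (-(A₂ : ℤ)) A₂),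
        ‖fourier2 (boxWeight q d₁ d₂ α β r i) (h.1 / (q * r : ℕ)) (h.2 / (q * r : ℕ))‖ *
          (dualCount (q * r) (α : ZMod (q * r)) (β : ZMod (q * r)) (h.1 : ZMod (q * r)) (h.2 : ZMod (q * r)) : ℝ) ≤
      (9 / 4 * ((2 : ℝ) ^ i.1 * 2 ^ i.2) *
          (((d₁ : ℝ) * d₂ * ((2 : ℝ) ^ i.1 * 2 ^ i.2) / 4) ^ (-(1 / 2 : ℝ)) *
            cutoffW ((d₁ : ℝ) * d₂ * ((2 : ℝ) ^ i.1 * 2 ^ i.2) / 4 / qhat q ^ 2) * (r : ℝ)⁻¹ *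
            (35 * (4 * π * Real.sqrt ((α : ℝ) * (β : ℝ) * ((2 : ℝ) ^ i.1 * 2 ^ i.2)) / ((q : ℝ) * r) / 2) ^
              (-(1 / 2 : ℝ))))) *
        ((2 * A₁ + 1) * (2 * A₂ / (q * r : ℕ) + 1)) := by
  have hq0 : (0 : ℝ) < q := by exact_mod_cast Nat.pos_of_ne_zero (NeZero.ne q)
  have hr0 : (0 : ℝ) < r := by exact_mod_cast hr
  have hα0 : (0 : ℝ) < α := by exact_mod_cast hα
  have hβ0 : (0 : ℝ) < β := by exact_mod_cast hβ
  have hZ : 0 < 4 * π * Real.sqrt ((α : ℝ) * (β : ℝ) * ((2 : ℝ) ^ i.1 * 2 ^ i.2)) / ((q : ℝ) * r) / 2 := by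
    have : 0 < Real.sqrt ((α : ℝ) * (β : ℝ) * ((2 : ℝ) ^ i.1 * 2 ^ i.2)) := Real.sqrt_pos.2 (by positivity)
    positivity
  refine sum_dualBox_norm_le hd₁ hd₂ hα hβ hunit i (by positivity) (fun x hx ↦ ?_) A₁ A₂
  have hx0 : 0 < x := lt_of_lt_of_le hZ hx
  calc |besselJ 1 x| ≤ 35 * x ^ (-(1 / 2 : ℝ)) := abs_besselJ_one_le_rpow hx0
    _ ≤ 35 * (4 * π * Real.sqrt ((α : ℝ) * (β : ℝ) * ((2 : ℝ) ^ i.1 * 2 ^ i.2)) / ((q : ℝ) * r) / 2) ^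
          (-(1 / 2 : ℝ)) :=
        mul_le_mul_of_nonneg_left (Real.rpow_le_rpow_of_nonpos hZ hx (by norm_num)) (by norm_num)

/-- **Prime level supplies the unit hypothesis**: for `q` prime, `1 ≤ α < q`, `(α, r) = 1`, the ledger
`sum_dualBox_norm_le` applies (`OffDiagDual.isUnit_natCast_primeLevel`). In `offDiag q l m` one has
`α = l/d₁ ≤ l ≤ M < q`. [cite: KowalskiMichelVanderKam2000, Lemma 3.3 p. 9 — derivation] -/
theorem sum_dualBox_norm_le_primeLevel [NeZero q] [NeZero (q * r)] (hq : q.Prime) (hd₁ : 1 ≤ d₁) (hd₂ : 1 ≤ d₂)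
    (hα : 1 ≤ α) (hαq : α < q) (hαr : Nat.Coprime α r) (hβ : 1 ≤ β) (i : ℕ × ℕ) {J : ℝ} (hJ0 : 0 ≤ J)
    (hJ : ∀ x : ℝ, 4 * π * Real.sqrt ((α : ℝ) * (β : ℝ) * ((2 : ℝ) ^ i.1 * 2 ^ i.2)) / ((q : ℝ) * r) / 2 ≤ x →
      |besselJ 1 x| ≤ J) (A₁ A₂ : ℕ) :
    ∑ h ∈ (Finset.Icc (-(A₁ : ℤ)) A₁) ×ˢ (Finset.Icc (-(A₂ : ℤ)) A₂),
        ‖fourier2 (boxWeight q d₁ d₂ α β r i) (h.1 / (q * r : ℕ)) (h.2 / (q * r : ℕ))‖ *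
          (dualCount (q * r) (α : ZMod (q * r)) (β : ZMod (q * r)) (h.1 : ZMod (q * r)) (h.2 : ZMod (q * r)) : ℝ) ≤
      (9 / 4 * ((2 : ℝ) ^ i.1 * 2 ^ i.2) *
          (((d₁ : ℝ) * d₂ * ((2 : ℝ) ^ i.1 * 2 ^ i.2) / 4) ^ (-(1 / 2 : ℝ)) *
            cutoffW ((d₁ : ℝ) * d₂ * ((2 : ℝ) ^ i.1 * 2 ^ i.2) / 4 / qhat q ^ 2) * (r : ℝ)⁻¹ * J)) *
        ((2 * A₁ + 1) * (2 * A₂ / (q * r : ℕ) + 1)) :=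
  sum_dualBox_norm_le hd₁ hd₂ hα hβ (isUnit_natCast_primeLevel hq hα hαq hαr) i hJ0 hJ A₁ A₂

end Summit.Parity.GeneralizedHardyLittlewood.Theorems.BeyondDiagonalBeatsQuarter.OffDiag
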